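import Mathlib
import HarnessLib
import Literature.Analysis.Calculus.ThirdOrderChainRule
import Literature.Analysis.Calculus.IteratedDifferenceBound
import Literature.MathematicalPhysics.QuantumLattice.HubbardSliceSymbolBandChain
import Summits.HubbardSuperconductivity.HubbardSuperconductivity.Theorems.KLProgrammeKLRegimeSliceSymbolLine
import Summits.HubbardSuperconductivity.HubbardSuperconductivity.Theorems.KLProgrammeKLRegimeSymbolLineDerivThree

/-!
# Route `KLProgramme` — engine support (route (L2), weighted lines): the single-slice propagator symbol composed with a `C³` band —
# THIRD differences along lattice lines (the anisotropic first-order term kept explicit)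

Cell `gate-hubbard-kl`, seat hubbard-kl-k3c3-p2 (g8), for the ENGINE child stmt-HubbardSuperconductivity-20437 (`stub_engine_step_norms`: the
WEIGHTED lines `KernelNormsWt4 … K_n j` and conjunct 3 (E4)ₙ via W1; located risk «(b)-Wt@j≥1»).  The order-three twin of k3c2-p3's
`KLProgrammeKLRegimeSliceSymbolLine` (orders `≤ 2`, `C²` band): the mixed master lemma
`KLProgrammeKLRegimeTorusL1MixedDifferencesMoment.sum_wt_norm_charSum_le_of_mixed_differences` (p3 g10) asks for POINTWISE single-direction THIRD
differences of the symbol along the axes, the normal and the tangent (isotropic rates); for the propagator factor `p ↦ Ψ̂_ω(e p)`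
(`Ψ̂ = sliceSymbolFnXi c 0 Λ Λ′ ω`, Literature `HubbardSliceSymbolSmoothMomentum` / `…XiThird`: `‖Ψ̂′‖ ≤ K₁ = (16B₁+16)c/Λ²`,
`‖Ψ̂″‖ ≤ K₂ = (32B₂+144B₁+128)c/Λ³`, `‖Ψ̂‴‖ ≤ K₃ = (64B₃+480B₂+1728B₁+1536)c/Λ⁴`) they come from the order-three chain along the path `s ↦ e(q + s•w)`
(Literature `ThirdOrderChainRule.hasDerivAt_chain3_comp`, `HubbardSliceSymbolBandChain.norm_sliceSymbolFnXi_comp_deriv3_le`) and the iterated mean value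
inequality (`IteratedDifferenceBound.norm_fwdDiff_iter_le_of_hasDerivAt`), with the band read through THREE derivatives (`‖D²e‖ ≤ K₂ᵉ`, `‖D³e‖ ≤ K₃ᵉ`;
p4/p3's `abs_fderiv_line_le`, `abs_iteratedDeriv_two_line_le`, `abs_iteratedDeriv_three_line_le`):

* §1 **`norm_fwdDiff_three_sliceSymbol_path_le`** — along a path `ξ` with derivatives `ξ₁, ξ₂, ξ₃` everywhere and `|ξ₁| ≤ a`, `|ξ₂| ≤ b`, `|ξ₃| ≤ b′`
  on `[x, x + 3δ]` (`δ ≥ 0`): `‖Δ_δ³(Ψ̂_ω ∘ ξ)(x)‖ ≤ δ³·(K₃a³ + 3K₂ab + K₁b′)`;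
* §2 **`norm_fwdDiff_three_sliceSymbol_line_le`** — for `e : V → ℝ` of class `C³` with `‖D²e‖ ≤ K₂ᵉ`, `‖D³e‖ ≤ K₃ᵉ`:
  `‖Δ_w³[p ↦ Ψ̂_ω(e p)](q)‖ ≤ K₃(|De(q)w| + 3K₂ᵉ‖w‖²)³ + 3K₂(|De(q)w| + 3K₂ᵉ‖w‖²)(K₂ᵉ‖w‖²) + K₁K₃ᵉ‖w‖³` — along the tangent of the frame's
  Fermi curve `|De(q)w|` is small (anisotropic gain), the curvature costs `K₂ᵉ`, and the third derivative of the band enters only LINEARLY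
  through `K₁K₃ᵉ‖w‖³` (the term that is isotropically sized for a flow frame, finding W1-TAN3).

Everything is proved; no definitions, no named facts. [folklore]

References: G. Benfatto, A. Giuliani, V. Mastropietro, Ann. Henri Poincaré 7 (2006) 809–898, (2.36aa), Lemma 2.2 (2.52)–(2.55), §3 (3.2)–(3.8);
M. Salmhofer, *Renormalization* (1999), §4.2.5 (4.70)–(4.71).
-/

noncomputable section

namespace Summit.HubbardSuperconductivity.HubbardSuperconductivity.Theorems.TorusFourierL2

set_option linter.dupNamespace false -- summit = problem name (single-conjunct summit), D-0017

open Set Complex Literature.MathematicalPhysics.QuantumLattice Literature.Probability.LatticeModels Literature.Analysis.Calculus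

/-! ### §1 The slice symbol along a `C³` path: third differences -/

section Path

variable {c Λ Λ' ω : ℝ}

/-- **Third difference along a `C³` path** (mean value inequality three times along the order-three chain): if `ξ` has derivatives
`ξ₁, ξ₂, ξ₃` everywhere with `|ξ₁| ≤ a`, `|ξ₂| ≤ b`, `|ξ₃| ≤ b′` on `[x, x + 3δ]` (`δ ≥ 0`), then
`‖Δ_δ³(Ψ̂_ω ∘ ξ)(x)‖ ≤ δ³·[(64B₃+480B₂+1728B₁+1536)(c/Λ⁴)a³ + 3(32B₂+144B₁+128)(c/Λ³)ab + (16B₁+16)(c/Λ²)b′]`.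
[cite: BenfattoGiulianiMastropietro2006, (2.36aa)] -/
theorem norm_fwdDiff_three_sliceSymbol_path_le (hΛ : 0 < Λ) (hΛΛ' : Λ ≤ Λ') (hc : 0 ≤ c) {B₁ B₂ B₃ : ℝ}
    (hB₁ : ∀ x, |deriv salmhoferCutoff x| ≤ B₁) (hB₂ : ∀ x, |deriv (deriv salmhoferCutoff) x| ≤ B₂)
    (hB₃ : ∀ x, |deriv (deriv (deriv salmhoferCutoff)) x| ≤ B₃)
    {ξ ξ₁ ξ₂ ξ₃ : ℝ → ℝ} (hξ : ∀ t, HasDerivAt ξ (ξ₁ t) t) (hξ₁ : ∀ t, HasDerivAt ξ₁ (ξ₂ t) t) (hξ₂ : ∀ t, HasDerivAt ξ₂ (ξ₃ t) t)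
    {x δ a b b' : ℝ} (hδ : 0 ≤ δ) (ha : ∀ t ∈ Icc x (x + 3 * δ), |ξ₁ t| ≤ a) (hb : ∀ t ∈ Icc x (x + 3 * δ), |ξ₂ t| ≤ b)
    (hb' : ∀ t ∈ Icc x (x + 3 * δ), |ξ₃ t| ≤ b') :
    ‖(fwdDiff δ)^[3] (fun t => sliceSymbolFnXi c 0 Λ Λ' ω (ξ t)) x‖ ≤
      δ ^ 3 * ((64 * B₃ + 480 * B₂ + 1728 * B₁ + 1536) * c / Λ ^ 4 * a ^ 3 +
        3 * ((32 * B₂ + 144 * B₁ + 128) * c / Λ ^ 3 * a * b) + (16 * B₁ + 16) * c / Λ ^ 2 * b') := by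
  have hB10 : 0 ≤ B₁ := (abs_nonneg _).trans (hB₁ 0)
  have hB20 : 0 ≤ B₂ := (abs_nonneg _).trans (hB₂ 0)
  have hB30 : 0 ≤ B₃ := (abs_nonneg _).trans (hB₃ 0)
  have hθ : |(0 : ℝ)| ≤ Λ / 4 := abs_zero_le_quarter hΛ
  set G : ℕ → ℝ → ℂ := fun k t =>
      if k = 0 then sliceSymbolFnXi c 0 Λ Λ' ω (ξ t)
      else if k = 1 then sliceSymbolFnXiD1 c 0 Λ Λ' ω (ξ t) * (ξ₁ t : ℂ)
      else if k = 2 then sliceSymbolFnXiD2 c 0 Λ Λ' ω (ξ t) * (ξ₁ t : ℂ) ^ 2 + sliceSymbolFnXiD1 c 0 Λ Λ' ω (ξ t) * (ξ₂ t : ℂ)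
      else if k = 3 then sliceSymbolFnXiD3 c 0 Λ Λ' ω (ξ t) * (ξ₁ t : ℂ) ^ 3 +
        3 * (sliceSymbolFnXiD2 c 0 Λ Λ' ω (ξ t) * (ξ₁ t : ℂ) * (ξ₂ t : ℂ)) + sliceSymbolFnXiD1 c 0 Λ Λ' ω (ξ t) * (ξ₃ t : ℂ)
      else 0 with hG
  have hchain : ∀ k < 3, ∀ t, HasDerivAt (G k) (G (k + 1) t) t :=
    hasDerivAt_sliceSymbolFnXi_comp_chain (c := c) (ω := ω) hΛ hΛΛ' hθ hξ hξ₁ hξ₂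
  set K : ℝ := (64 * B₃ + 480 * B₂ + 1728 * B₁ + 1536) * c / Λ ^ 4 * a ^ 3 +
      3 * ((32 * B₂ + 144 * B₁ + 128) * c / Λ ^ 3 * a * b) + (16 * B₁ + 16) * c / Λ ^ 2 * b' with hK
  have hbound : ∀ s ∈ Icc x (x + 3 * δ), ‖G 3 s‖ ≤ K := by
    intro s hs
    have ha0 : 0 ≤ a := (abs_nonneg _).trans (ha s hs)
    have hb0 : 0 ≤ b := (abs_nonneg _).trans (hb s hs)
    have h3 : G 3 s = sliceSymbolFnXiD3 c 0 Λ Λ' ω (ξ s) * (ξ₁ s : ℂ) ^ 3 +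
        3 * (sliceSymbolFnXiD2 c 0 Λ Λ' ω (ξ s) * (ξ₁ s : ℂ) * (ξ₂ s : ℂ)) + sliceSymbolFnXiD1 c 0 Λ Λ' ω (ξ s) * (ξ₃ s : ℂ) := by
      simp [hG]
    rw [h3]
    refine (norm_sliceSymbolFnXi_comp_deriv3_le hΛ hΛΛ' hθ hc hB₁ hB₂ hB₃ (ξ s) (ξ₁ s) (ξ₂ s) (ξ₃ s)).trans ?_
    have k1 : 0 ≤ (64 * B₃ + 480 * B₂ + 1728 * B₁ + 1536) * c / Λ ^ 4 := by positivity
    have k2 : 0 ≤ (32 * B₂ + 144 * B₁ + 128) * c / Λ ^ 3 := by positivity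
    have k3 : 0 ≤ (16 * B₁ + 16) * c / Λ ^ 2 := by positivity
    have e1 : |ξ₁ s| ^ 3 ≤ a ^ 3 := pow_le_pow_left₀ (abs_nonneg _) (ha s hs) 3
    have e2 : |ξ₁ s| * |ξ₂ s| ≤ a * b := mul_le_mul (ha s hs) (hb s hs) (abs_nonneg _) ha0
    rw [hK]
    refine add_le_add (add_le_add (mul_le_mul_of_nonneg_left e1 k1) (mul_le_mul_of_nonneg_left ?_ (by norm_num)))
      (mul_le_mul_of_nonneg_left (hb' s hs) k3)
    rw [mul_assoc, mul_assoc]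
    exact mul_le_mul_of_nonneg_left e2 k2
  have h := Literature.Analysis.norm_fwdDiff_iter_le_of_hasDerivAt hδ 3 G x K (fun k hk s _ => hchain k hk s)
    (fun s hs => hbound s (by simpa using hs))
  have h0 : G 0 = fun s => sliceSymbolFnXi c 0 Λ Λ' ω (ξ s) := by funext s; simp [hG]
  rw [h0] at h
  exact h

end Path

/-! ### §2 The line instance: `ξ(s) = e(q + s•w)` for a `C³` band `e` with `‖D²e‖ ≤ K₂ᵉ`, `‖D³e‖ ≤ K₃ᵉ` -/

section Line

variable {V : Type*} [NormedAddCommGroup V] [NormedSpace ℝ V] {c Λ Λ' ω : ℝ}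

/-- A `C³` band is `C²`. [folklore] -/
theorem contDiff_two_of_contDiff_three {e : V → ℝ} (he : ContDiff ℝ 3 e) : ContDiff ℝ 2 e := he.of_le (by norm_num)

/-- The second-derivative path `s ↦ ∂ₛ²e(q + s•w)` has derivative `∂ₛ³e(q + s•w)` (for a `C³` band). [folklore] -/
theorem hasDerivAt_line_deriv_two {e : V → ℝ} (he : ContDiff ℝ 3 e) (q w : V) (s : ℝ) :
    HasDerivAt (iteratedDeriv 2 (fun s : ℝ => e (q + s • w))) (iteratedDeriv 3 (fun s : ℝ => e (q + s • w)) s) s :=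
  hasDerivAt_iteratedDeriv_two_of_contDiff_three (contDiff_three_line he q w) s

/-- **Third difference of the slice symbol along a lattice line** (`C³` data of the band): for `e : V → ℝ` of class `C³` with
`‖D²e‖ ≤ K₂ᵉ` and `‖D³e‖ ≤ K₃ᵉ`,
`‖Δ_w³[p ↦ Ψ̂_ω(e p)](q)‖ ≤ K₃(|De(q)w| + 3K₂ᵉ‖w‖²)³ + 3K₂(|De(q)w| + 3K₂ᵉ‖w‖²)(K₂ᵉ‖w‖²) + K₁(K₃ᵉ‖w‖³)` with the slice symbol's constants
`K₁ = (16B₁+16)c/Λ²`, `K₂ = (32B₂+144B₁+128)c/Λ³`, `K₃ = (64B₃+480B₂+1728B₁+1536)c/Λ⁴` — the first-order term `|De(q)w|` is the one that is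
small along the tangent of the frame's Fermi curve, the band's third derivative enters only through the last (linear) term.
[cite: BenfattoGiulianiMastropietro2006, Lemma 2.2 (2.36aa), (2.52)–(2.55)] -/
theorem norm_fwdDiff_three_sliceSymbol_line_le {e : V → ℝ} (he : ContDiff ℝ 3 e) {K₂ K₃ : ℝ}
    (hK₂ : ∀ p, ‖iteratedFDeriv ℝ 2 e p‖ ≤ K₂) (hK₃ : ∀ p, ‖iteratedFDeriv ℝ 3 e p‖ ≤ K₃)
    (hΛ : 0 < Λ) (hΛΛ' : Λ ≤ Λ') (hc : 0 ≤ c) {B₁ B₂ B₃ : ℝ} (hB₁ : ∀ x, |deriv salmhoferCutoff x| ≤ B₁)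
    (hB₂ : ∀ x, |deriv (deriv salmhoferCutoff) x| ≤ B₂) (hB₃ : ∀ x, |deriv (deriv (deriv salmhoferCutoff)) x| ≤ B₃) (q w : V) :
    ‖(fwdDiff w)^[3] (fun p => sliceSymbolFnXi c 0 Λ Λ' ω (e p)) q‖ ≤
      (64 * B₃ + 480 * B₂ + 1728 * B₁ + 1536) * c / Λ ^ 4 * (|fderiv ℝ e q w| + 3 * (K₂ * ‖w‖ ^ 2)) ^ 3 +
        3 * ((32 * B₂ + 144 * B₁ + 128) * c / Λ ^ 3 * (|fderiv ℝ e q w| + 3 * (K₂ * ‖w‖ ^ 2)) * (K₂ * ‖w‖ ^ 2)) +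
        (16 * B₁ + 16) * c / Λ ^ 2 * (K₃ * ‖w‖ ^ 3) := by
  have he2 : ContDiff ℝ 2 e := contDiff_two_of_contDiff_three he
  -- reduce to the real line through `q` along `w`
  have e0 := Literature.Analysis.Calculus.fwdDiff_iter_apply_add_smul q w 3 (fun p => sliceSymbolFnXi c 0 Λ Λ' ω (e p)) 0
  rw [zero_smul, add_zero] at e0
  rw [e0]
  have h := norm_fwdDiff_three_sliceSymbol_path_le (ω := ω) hΛ hΛΛ' hc hB₁ hB₂ hB₃ (ξ := fun s : ℝ => e (q + s • w))
    (ξ₁ := fun s : ℝ => fderiv ℝ e (q + s • w) w) (ξ₂ := fun s : ℝ => iteratedDeriv 2 (fun s : ℝ => e (q + s • w)) s)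
    (ξ₃ := fun s : ℝ => iteratedDeriv 3 (fun s : ℝ => e (q + s • w)) s)
    (fun t => hasDerivAt_line he2 q w t) (fun t => hasDerivAt_line_deriv he2 q w t) (fun t => hasDerivAt_line_deriv_two he q w t)
    (x := 0) (δ := 1) (a := |fderiv ℝ e q w| + 3 * (K₂ * ‖w‖ ^ 2)) (b := K₂ * ‖w‖ ^ 2) (b' := K₃ * ‖w‖ ^ 3) zero_le_one
    (fun t ht => ?_) (fun t _ => abs_iteratedDeriv_two_line_le he2 hK₂ q w t) (fun t _ => abs_iteratedDeriv_three_line_le he hK₃ q w t)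
  · simpa only [one_pow, one_mul] using h
  · have hK0 : 0 ≤ K₂ := le_trans (norm_nonneg _) (hK₂ q)
    have h1 := abs_fderiv_line_le he2 hK₂ q w t
    have ht3 : |t| ≤ 3 := by
      rw [abs_of_nonneg ht.1]; linarith [ht.2]
    have : K₂ * ‖w‖ ^ 2 * |t| ≤ 3 * (K₂ * ‖w‖ ^ 2) := by nlinarith [mul_nonneg hK0 (sq_nonneg ‖w‖)]
    linarith

/-- **Third difference along a lattice line, uniform form**: if moreover `|De(q)w| ≤ τ` then
`‖Δ_w³[p ↦ Ψ̂_ω(e p)](q)‖ ≤ K₃(τ + 3K₂ᵉ‖w‖²)³ + 3K₂(τ + 3K₂ᵉ‖w‖²)(K₂ᵉ‖w‖²) + K₁(K₃ᵉ‖w‖³)` (the form the torus transport consumes: along the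
normal/axes `τ = ‖De‖‖w‖`, along the tangent `τ` = the sector's tangential datum). [cite: BenfattoGiulianiMastropietro2006, Lemma 2.2 (2.52)–(2.55)] -/
theorem norm_fwdDiff_three_sliceSymbol_line_le_of_le {e : V → ℝ} (he : ContDiff ℝ 3 e) {K₂ K₃ : ℝ}
    (hK₂ : ∀ p, ‖iteratedFDeriv ℝ 2 e p‖ ≤ K₂) (hK₃ : ∀ p, ‖iteratedFDeriv ℝ 3 e p‖ ≤ K₃)
    (hΛ : 0 < Λ) (hΛΛ' : Λ ≤ Λ') (hc : 0 ≤ c) {B₁ B₂ B₃ : ℝ} (hB₁ : ∀ x, |deriv salmhoferCutoff x| ≤ B₁)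
    (hB₂ : ∀ x, |deriv (deriv salmhoferCutoff) x| ≤ B₂) (hB₃ : ∀ x, |deriv (deriv (deriv salmhoferCutoff)) x| ≤ B₃) (q w : V)
    {τ : ℝ} (hτ : |fderiv ℝ e q w| ≤ τ) :
    ‖(fwdDiff w)^[3] (fun p => sliceSymbolFnXi c 0 Λ Λ' ω (e p)) q‖ ≤
      (64 * B₃ + 480 * B₂ + 1728 * B₁ + 1536) * c / Λ ^ 4 * (τ + 3 * (K₂ * ‖w‖ ^ 2)) ^ 3 +
        3 * ((32 * B₂ + 144 * B₁ + 128) * c / Λ ^ 3 * (τ + 3 * (K₂ * ‖w‖ ^ 2)) * (K₂ * ‖w‖ ^ 2)) +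
        (16 * B₁ + 16) * c / Λ ^ 2 * (K₃ * ‖w‖ ^ 3) := by
  have hB10 : 0 ≤ B₁ := (abs_nonneg _).trans (hB₁ 0)
  have hB20 : 0 ≤ B₂ := (abs_nonneg _).trans (hB₂ 0)
  have hB30 : 0 ≤ B₃ := (abs_nonneg _).trans (hB₃ 0)
  have hK0 : 0 ≤ K₂ := le_trans (norm_nonneg _) (hK₂ q)
  refine (norm_fwdDiff_three_sliceSymbol_line_le he hK₂ hK₃ hΛ hΛΛ' hc hB₁ hB₂ hB₃ q w).trans ?_
  have k1 : 0 ≤ (64 * B₃ + 480 * B₂ + 1728 * B₁ + 1536) * c / Λ ^ 4 := by positivity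
  have k2 : 0 ≤ (32 * B₂ + 144 * B₁ + 128) * c / Λ ^ 3 := by positivity
  have s0 : 0 ≤ |fderiv ℝ e q w| + 3 * (K₂ * ‖w‖ ^ 2) := by positivity
  have s1 : |fderiv ℝ e q w| + 3 * (K₂ * ‖w‖ ^ 2) ≤ τ + 3 * (K₂ * ‖w‖ ^ 2) := by linarith
  have e1 := pow_le_pow_left₀ s0 s1 3
  have e2 : (|fderiv ℝ e q w| + 3 * (K₂ * ‖w‖ ^ 2)) * (K₂ * ‖w‖ ^ 2) ≤ (τ + 3 * (K₂ * ‖w‖ ^ 2)) * (K₂ * ‖w‖ ^ 2) :=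
    mul_le_mul_of_nonneg_right s1 (by positivity)
  refine add_le_add (add_le_add (mul_le_mul_of_nonneg_left e1 k1) (mul_le_mul_of_nonneg_left ?_ (by norm_num))) le_rfl
  rw [mul_assoc, mul_assoc]
  exact mul_le_mul_of_nonneg_left e2 k2

end Line

end Summit.HubbardSuperconductivity.HubbardSuperconductivity.Theorems.TorusFourierL2

end
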